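import Mathlib
import Summits.NavierStokesRegularity.NavierStokesRegularity.Theorems.SubcriticalEnvelopeForwardSourceTailEnvelopeKPNormalForm
import Summits.NavierStokesRegularity.NavierStokesRegularity.Theorems.SubcriticalEnvelopeForwardSourceSmoothingShell
import HarnessLib

/-!
# KP networks proper: low energies never increase and DARK MODES STAY DARK (helper file for crux
# stmt-NavierStokesRegularity-27057 `SubOnsagerCeiling.ForwardTailCeilingKP`, `--supports`; registered stubs
# `stub_primaryGradedLargeRatio` / `stub_primaryGradedSmallRatio` of the LEAD skeleton
# `Cruxes/ForwardTailCeilingKP/Lines/kp_shell_barrier.lean`; part 1 of 2, part 2 = `…KPDarkShellBarrier.lean`)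

The two registered stubs ask, for EVERY KP network proper `α ∈ E₂(R)` (symmetric (4.2), cancelling (4.3),
comparable, ORTHANT, DIAGONAL feed forms) and every `ε₀` in their range, for a grading of the modes whose
level-0 modes obey a ν-UNIFORM weighted shell barrier `(1+ε₀)^{2θk}·½X_{i,k}(t)² ≤ D·E₀`, `1/2 < θ ≤ 1`
(`PrimaryGradedAt R ε₀ α`).  All landed rungs concern RECURRENT architectures (the one-mode chain, uniform
permutation / fan networks, the 2-cycle, the side-branch class).  This file and its sequel settle the
complementary NON-RECURRENT corner once and for all scale ratios, from the normal form `kpProper_quadTerm`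
(p640757) and the shell-energy flux chain `kpProper_shellEnergy_identity`:

* §1 `kpProper_lowEnergy_le` — **low energies never increase**: along every honest non-negative ν-viscous
  solution from a one-shell datum, `Σ_{m ≤ n} Σ_i ½X_{i,m}(t)² ≤ E₀` for every `n` (the bond fluxes
  `(1+ε₀)^{5n/2} Σ w_{ij} X_{i,n}² X_{j,n+1}` of the flux chain are `≥ 0`: energy only moves UP the shells);
  hence `kpProper_half_sq_le_energy`: `½X_{i,k}(t)² ≤ E₀` for every mode, uniformly in `ν` (the trivial
  `θ = 0` barrier of the whole class).
* §2 `kpProper_dark_step` — **dark modes stay dark** (finite-dimensional Grönwall on one shell): if the modes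
  outside `A` vanish on shell `n` along the window, no mode of `A` feeds a mode outside `B`
  (`α a a i (0,0,1) = 0`) and no in-shell coupling of two modes of `B` drives a mode outside `B`
  (`α a b i (0,0,0) = 0`), then the modes outside `B` vanish on shell `n+1`: their energy `y` obeys
  `y' ≤ 160·M·(1+ε₀)^{5(n+1)/2}·y`, `y(0) = 0` (pure algebra: `kpDark_inShell_le`, `kpDark_drain_le`).
* §3 `kpProper_dark_zero` — induction along a LIT-SET CERTIFICATE `A : ℕ → Finset (Fin 4)` (`A 0 = univ`,
  the two closure clauses at every shell): `X_{i,n} ≡ 0` on `[0,s]` for every `i ∉ A n`.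

The sequel turns a certificate that EMPTIES from some shell `K` on (a DARK SHELL) into the ν-uniform barrier
`θ = 1`, `D = (1+ε₀)^{2K}` and into the conclusion of `PrimaryGradedAt R ε₀ α` verbatim (grading `lev ≡ 0`),
in particular for every RANKED (feed-forward) network — so inside both stubs only the RECURRENT networks
remain, which is where the open-in-print content (λ-uniform Barbato–Morandin–Romito) lives.
HONEST FRAMING: statements about Tao-type MODEL lattice ODEs (route SubOnsagerCeiling, rung TL-M2Break); a
degenerate corner of the registered stubs, not the stubs; nothing here bears on Navier–Stokes regularity
and no crux or summit is proved. [cite: Tao2016AveragedNS, §4 (4.2)–(4.3), (4.8), (4.13)]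
[cite: Teschl2012, §2.4 (Grönwall)]
-/

noncomputable section

-- the sub-problem namespace `NavierStokesRegularity.NavierStokesRegularity` is the tree's layout (D-0017)
set_option linter.dupNamespace false

namespace Summit.NavierStokesRegularity.NavierStokesRegularity.Theorems

open Set Finset
open Literature.Analysis.FluidPDE.TaoCascade

variable {α : Fin 4 → Fin 4 → Fin 4 → ℤ × ℤ × ℤ → ℝ}

/-! ## §1 Low energies never increase -/

/-- **LOW ENERGIES OF A KP NETWORK PROPER NEVER INCREASE.**  Along an honest non-negative `ν`-viscous
solution (`ν ≥ 0`) from a one-shell datum `X₀` on shell `0` (no negative shells), for every `n : ℕ` and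
every `t ∈ [0,s]`: `Σ_{m=0}^{n} Σ_i ½X_{i,m}(t)² ≤ Σ_i ½(X₀)_i²`.  Proof: by the shell-energy identity
`kpProper_shellEnergy_identity` the in-fluxes telescope, the in-flux of shell `0` vanishes, the out-flux of
shell `n` is `≥ 0` (feed weights `≥ 0`, receiving amplitudes `≥ 0` on shell `n+1 ≥ 1`), dissipation is
`≥ 0`; Grönwall with rate `0`. MODEL lattice statement. [cite: Tao2016AveragedNS, §4 (4.8)–(4.9), (4.13)] -/
theorem kpProper_lowEnergy_le (hs : IsSymmetricCoeff α) (hc : IsCancellingCoeff α)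
    (hO : ∀ (Y : Fin 4 → ℤ → ℝ → ℝ) (τ : ℝ), (∀ (j : Fin 4) (k : ℤ), 1 ≤ k → 0 ≤ Y j k τ) →
      ∀ δ : ℝ, 0 < δ → ∀ (i : Fin 4) (n : ℤ), 1 ≤ n → Y i n τ = 0 → 0 ≤ quadTerm δ α Y i n τ)
    (hD : ∀ a b i : Fin 4, a ≠ b → α a b i (0, 0, 1) = 0)
    {ε₀ ν s : ℝ} (hε : 0 < 1 + ε₀) (hν : 0 ≤ ν) {X₀ : Fin 4 → ℝ} {X : Fin 4 → ℤ → ℝ → ℝ}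
    (hdat : ∀ (i : Fin 4) (k : ℤ), X i k 0 = if k = 0 then X₀ i else 0)
    (hvan : ∀ (i : Fin 4) (k : ℤ), k < 0 → ∀ t : ℝ, X i k t = 0)
    (hXc : ∀ (i : Fin 4) (k : ℤ), Continuous (X i k))
    (hode : ∀ (i : Fin 4) (k : ℤ), ∀ t ∈ Icc (0 : ℝ) s, HasDerivWithinAt (X i k)
      (quadTerm ε₀ α X i k t - ν * (1 + ε₀) ^ ((2 : ℝ) * k) * X i k t) (Icc (0 : ℝ) s) t)
    (hnn : ∀ t ∈ Icc (0 : ℝ) s, ∀ (i : Fin 4) (k : ℤ), 1 ≤ k → 0 ≤ X i k t) (n : ℕ) :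
    ∀ t ∈ Icc (0 : ℝ) s,
      ∑ m ∈ Finset.range (n + 1), ∑ i, (1 / 2 : ℝ) * X i (m : ℤ) t ^ 2 ≤ ∑ i, (1 / 2 : ℝ) * X₀ i ^ 2 := by
  -- the in-flux of shell `m`
  set IN : ℕ → ℝ → ℝ := fun m τ => (1 + ε₀) ^ ((5 : ℝ) * (((m : ℤ) : ℝ) - 1) / 2) *
    ∑ i, ∑ a, α a a i (0, 0, 1) * X a ((m : ℤ) - 1) τ ^ 2 * X i (m : ℤ) τ with hIN
  have hflux : ∀ (m : ℕ) (τ : ℝ),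
      ∑ i, X i (m : ℤ) τ * quadTerm ε₀ α X i (m : ℤ) τ = IN m τ - IN (m + 1) τ := by
    intro m τ
    rw [kpProper_shellEnergy_identity hs hc hO hD ε₀ X (m : ℤ) τ,
      kpProper_outFlux_eq_inFlux_succ ε₀ X (m : ℤ) τ]
    simp only [hIN]
    push_cast
    simp only [add_sub_cancel_right]
  -- the low energy and its derivative
  set y : ℝ → ℝ := fun τ => ∑ m ∈ Finset.range (n + 1), ∑ i, (1 / 2 : ℝ) * X i (m : ℤ) τ ^ 2 with hy
  set y' : ℝ → ℝ := fun τ => ∑ m ∈ Finset.range (n + 1),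
    (∑ i, X i (m : ℤ) τ * quadTerm ε₀ α X i (m : ℤ) τ -
      2 * (ν * (1 + ε₀) ^ ((2 : ℝ) * ((m : ℤ) : ℝ))) * ∑ i, (1 / 2 : ℝ) * X i (m : ℤ) τ ^ 2) with hy'
  have hyc : ContinuousOn y (Icc 0 s) := by
    refine Continuous.continuousOn ?_
    exact continuous_finsetSum _ fun m _ =>
      forwardSourceSmoothing_continuous_denergy Finset.univ (m : ℤ) (fun i => hXc i _)
  have hyd : ∀ τ ∈ Icc (0 : ℝ) s, HasDerivWithinAt y (y' τ) (Icc 0 s) τ := by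
    intro τ hτ
    exact HasDerivWithinAt.fun_sum (u := Finset.range (n + 1))
      (A := fun m θ => ∑ i, (1 / 2 : ℝ) * X i (m : ℤ) θ ^ 2)
      (A' := fun m => ∑ i, X i (m : ℤ) τ * quadTerm ε₀ α X i (m : ℤ) τ -
        2 * (ν * (1 + ε₀) ^ ((2 : ℝ) * ((m : ℤ) : ℝ))) * ∑ i, (1 / 2 : ℝ) * X i (m : ℤ) τ ^ 2)
      (fun m _ => forwardSourceSmoothing_hasDerivWithinAt_denergy Finset.univ (m : ℤ)
        (fun i => hode i (m : ℤ)) hτ)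
  have hb : ∀ τ ∈ Icc (0 : ℝ) s, y' τ ≤ 0 * y τ + 0 := by
    intro τ hτ
    have h1 : ∑ m ∈ Finset.range (n + 1), ∑ i, X i (m : ℤ) τ * quadTerm ε₀ α X i (m : ℤ) τ =
        IN 0 τ - IN (n + 1) τ := by
      rw [Finset.sum_congr rfl fun m _ => hflux m τ]
      exact Finset.sum_range_sub' (fun m => IN m τ) (n + 1)
    have hIN0 : IN 0 τ = 0 := by
      have hz : ∀ a, X a (((0 : ℕ) : ℤ) - 1) τ = 0 := fun a => hvan a _ (by norm_num) τ
      simp only [hIN, hz]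
      simp
    have hINpos : 0 ≤ IN (n + 1) τ := by
      simp only [hIN]
      refine mul_nonneg (Real.rpow_pos_of_pos hε _).le
        (Finset.sum_nonneg fun i _ => Finset.sum_nonneg fun a _ => ?_)
      refine mul_nonneg (mul_nonneg (kpProper_feed_nonneg hO a i) (sq_nonneg _)) ?_
      exact hnn τ hτ i _ (by push_cast; linarith)
    have hdiss : 0 ≤ ∑ m ∈ Finset.range (n + 1),
        2 * (ν * (1 + ε₀) ^ ((2 : ℝ) * ((m : ℤ) : ℝ))) * ∑ i, (1 / 2 : ℝ) * X i (m : ℤ) τ ^ 2 :=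
      Finset.sum_nonneg fun m _ => mul_nonneg
        (mul_nonneg (by norm_num) (mul_nonneg hν (Real.rpow_pos_of_pos hε _).le))
        (Finset.sum_nonneg fun i _ => by positivity)
    have : y' τ = (∑ m ∈ Finset.range (n + 1), ∑ i, X i (m : ℤ) τ * quadTerm ε₀ α X i (m : ℤ) τ) -
        ∑ m ∈ Finset.range (n + 1),
          2 * (ν * (1 + ε₀) ^ ((2 : ℝ) * ((m : ℤ) : ℝ))) * ∑ i, (1 / 2 : ℝ) * X i (m : ℤ) τ ^ 2 := by
      simp only [hy', Finset.sum_sub_distrib]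
    rw [this, h1, hIN0]
    linarith
  have hy0 : y 0 = ∑ i, (1 / 2 : ℝ) * X₀ i ^ 2 := by
    have hne : ∀ m : ℕ, (m : ℤ) + 1 ≠ 0 := fun m => by omega
    simp only [hy]
    rw [Finset.sum_range_succ']
    simp [hdat, hne]
  intro t ht
  have h := forwardSourceSmoothing_le_gronwallBound hyc hyd hb t ht
  rw [gronwallBound_K0] at h
  have h2 : y t ≤ y 0 := by simpa using h
  rw [hy0] at h2
  exact h2

/-- **Every mode of a KP network proper carries at most the initial energy**, uniformly in `ν ≥ 0`:
`½X_{i,k}(t)² ≤ Σ_j ½(X₀)_j²` for every `i`, every shell `k : ℕ` and every `t ∈ [0,s]` (the trivial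
`θ = 0` barrier of the whole class). MODEL lattice statement. [cite: Tao2016AveragedNS, §4 (4.13)] -/
theorem kpProper_half_sq_le_energy (hs : IsSymmetricCoeff α) (hc : IsCancellingCoeff α)
    (hO : ∀ (Y : Fin 4 → ℤ → ℝ → ℝ) (τ : ℝ), (∀ (j : Fin 4) (k : ℤ), 1 ≤ k → 0 ≤ Y j k τ) →
      ∀ δ : ℝ, 0 < δ → ∀ (i : Fin 4) (n : ℤ), 1 ≤ n → Y i n τ = 0 → 0 ≤ quadTerm δ α Y i n τ)
    (hD : ∀ a b i : Fin 4, a ≠ b → α a b i (0, 0, 1) = 0)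
    {ε₀ ν s : ℝ} (hε : 0 < 1 + ε₀) (hν : 0 ≤ ν) {X₀ : Fin 4 → ℝ} {X : Fin 4 → ℤ → ℝ → ℝ}
    (hdat : ∀ (i : Fin 4) (k : ℤ), X i k 0 = if k = 0 then X₀ i else 0)
    (hvan : ∀ (i : Fin 4) (k : ℤ), k < 0 → ∀ t : ℝ, X i k t = 0)
    (hXc : ∀ (i : Fin 4) (k : ℤ), Continuous (X i k))
    (hode : ∀ (i : Fin 4) (k : ℤ), ∀ t ∈ Icc (0 : ℝ) s, HasDerivWithinAt (X i k)
      (quadTerm ε₀ α X i k t - ν * (1 + ε₀) ^ ((2 : ℝ) * k) * X i k t) (Icc (0 : ℝ) s) t)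
    (hnn : ∀ t ∈ Icc (0 : ℝ) s, ∀ (i : Fin 4) (k : ℤ), 1 ≤ k → 0 ≤ X i k t) :
    ∀ t ∈ Icc (0 : ℝ) s, ∀ (i : Fin 4) (k : ℕ),
      (1 / 2 : ℝ) * X i (k : ℤ) t ^ 2 ≤ ∑ j, (1 / 2 : ℝ) * X₀ j ^ 2 := by
  intro t ht i k
  have h := kpProper_lowEnergy_le hs hc hO hD hε hν hdat hvan hXc hode hnn k t ht
  refine le_trans ?_ h
  have h1 : (1 / 2 : ℝ) * X i (k : ℤ) t ^ 2 ≤ ∑ j, (1 / 2 : ℝ) * X j (k : ℤ) t ^ 2 :=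
    Finset.single_le_sum (f := fun j => (1 / 2 : ℝ) * X j (k : ℤ) t ^ 2) (fun j _ => by positivity)
      (Finset.mem_univ i)
  refine h1.trans ?_
  exact Finset.single_le_sum (f := fun m => ∑ j, (1 / 2 : ℝ) * X j ((m : ℕ) : ℤ) t ^ 2)
    (fun m _ => Finset.sum_nonneg fun j _ => by positivity) (Finset.self_mem_range_succ k)

/-! ## §2 Dark modes stay dark: one shell -/

/-- **In-shell couplings cannot light a dark mode** (algebra on `Fin 4`): if `|m a b| ≤ 1`, `|x a| ≤ M`,
`m a b = 0` whenever `a, b ∈ B`, and `d ∉ B`, then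
`x_d · Σ_{a,b} m_{ab} x_a x_b ≤ 32·M·Σ_{e ∉ B} ½x_e²` — every surviving monomial has a factor `x_e`, `e ∉ B`,
besides `x_d`. [folklore; this file] -/
theorem kpDark_inShell_le (m : Fin 4 → Fin 4 → ℝ) (x : Fin 4 → ℝ) {M : ℝ} (hm : ∀ a b, |m a b| ≤ 1)
    (hx : ∀ a, |x a| ≤ M) (B : Finset (Fin 4)) (hB : ∀ a ∈ B, ∀ b ∈ B, m a b = 0) {d : Fin 4}
    (hd : d ∉ B) :
    x d * ∑ a, ∑ b, m a b * (x a * x b) ≤ 32 * M * ∑ e ∈ Bᶜ, (1 / 2 : ℝ) * x e ^ 2 := by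
  set y : ℝ := ∑ e ∈ Bᶜ, (1 / 2 : ℝ) * x e ^ 2 with hy
  have hM0 : 0 ≤ M := (abs_nonneg _).trans (hx d)
  have hy0 : 0 ≤ y := Finset.sum_nonneg fun e _ => by positivity
  have hmem : ∀ {e}, e ∉ B → (1 / 2 : ℝ) * x e ^ 2 ≤ y := fun {e} he =>
    Finset.single_le_sum (f := fun e => (1 / 2 : ℝ) * x e ^ 2) (fun e _ => by positivity)
      (Finset.mem_compl.2 he)
  have hdy : (1 / 2 : ℝ) * x d ^ 2 ≤ y := hmem hd
  -- one monomial with a dark factor `x e`: `|x_d m x_a x_b| ≤ M |x_d| |x_e| ≤ M (½x_d² + ½x_e²) ≤ 2My`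
  have hmono : ∀ {e u : Fin 4} (a b : Fin 4), e ∉ B → (x a * x b = x e * x u) →
      x d * (m a b * (x a * x b)) ≤ 2 * M * y := by
    intro e u a b he hab
    have hey : (1 / 2 : ℝ) * x e ^ 2 ≤ y := hmem he
    have h1 : |x d * (m a b * (x a * x b))| ≤ M * (|x d| * |x e|) := by
      rw [hab, abs_mul, abs_mul, abs_mul]
      have h2 : |m a b| * (|x e| * |x u|) ≤ 1 * (|x e| * M) :=
        mul_le_mul (hm a b) (mul_le_mul_of_nonneg_left (hx u) (abs_nonneg _)) (by positivity)
          zero_le_one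
      calc |x d| * (|m a b| * (|x e| * |x u|)) ≤ |x d| * (1 * (|x e| * M)) :=
            mul_le_mul_of_nonneg_left h2 (abs_nonneg _)
        _ = M * (|x d| * |x e|) := by ring
    have h3 : |x d| * |x e| ≤ (1 / 2 : ℝ) * x d ^ 2 + (1 / 2 : ℝ) * x e ^ 2 := by
      nlinarith [sq_nonneg (|x d| - |x e|), sq_abs (x d), sq_abs (x e)]
    calc x d * (m a b * (x a * x b)) ≤ |x d * (m a b * (x a * x b))| := le_abs_self _
      _ ≤ M * (|x d| * |x e|) := h1
      _ ≤ M * ((1 / 2 : ℝ) * x d ^ 2 + (1 / 2 : ℝ) * x e ^ 2) := mul_le_mul_of_nonneg_left h3 hM0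
      _ ≤ 2 * M * y := by nlinarith
  have key : ∀ a b, x d * (m a b * (x a * x b)) ≤ 2 * M * y := by
    intro a b
    by_cases ha : a ∈ B
    · by_cases hb : b ∈ B
      · rw [hB a ha b hb]
        have : x d * (0 * (x a * x b)) = 0 := by ring
        rw [this]
        positivity
      · exact hmono (e := b) (u := a) a b hb (by ring)
    · exact hmono (e := a) (u := b) a b ha rfl
  calc x d * ∑ a, ∑ b, m a b * (x a * x b) = ∑ a, ∑ b, x d * (m a b * (x a * x b)) := by
        rw [Finset.mul_sum]
        exact Finset.sum_congr rfl fun a _ => Finset.mul_sum _ _ _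
    _ ≤ ∑ _a : Fin 4, ∑ _b : Fin 4, 2 * M * y := Finset.sum_le_sum fun a _ => Finset.sum_le_sum fun b _ => key a b
    _ = 32 * M * y := by simp [Finset.sum_const, Finset.card_univ, Fintype.card_fin]; ring

/-- **A dark mode's feed drain is at most quadratic in itself**: with `|w j| ≤ 1`, `|z j| ≤ M` and `L ≥ 0`,
`−(L·(x·Σ_j w_j z_j))·x ≤ 4ML·x²`. [folklore; this file] -/
theorem kpDark_drain_le (w z : Fin 4 → ℝ) {M L x : ℝ} (hw : ∀ j, |w j| ≤ 1) (hz : ∀ j, |z j| ≤ M)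
    (hL : 0 ≤ L) : -(x * (L * (x * ∑ j, w j * z j))) ≤ 4 * M * L * x ^ 2 := by
  have hS : |∑ j, w j * z j| ≤ 4 * M := by
    calc |∑ j, w j * z j| ≤ ∑ j, |w j * z j| := Finset.abs_sum_le_sum_abs _ _
      _ ≤ ∑ _j : Fin 4, M := Finset.sum_le_sum fun j _ => by
          rw [abs_mul]
          calc |w j| * |z j| ≤ 1 * M := mul_le_mul (hw j) (hz j) (abs_nonneg _) zero_le_one
            _ = M := one_mul M
      _ = 4 * M := by simp [Finset.sum_const, Finset.card_univ, Fintype.card_fin]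
  have h1 : -(4 * M) ≤ ∑ j, w j * z j := (abs_le.1 hS).1
  have h2 : x * (L * (x * ∑ j, w j * z j)) = (L * x ^ 2) * ∑ j, w j * z j := by ring
  rw [h2]
  nlinarith [mul_nonneg hL (sq_nonneg x)]

/-- **DARK MODES STAY DARK (one shell up).**  KP network proper, `|α| ≤ 1` on the shift set, a family `X`
with `|X| ≤ M`, continuous, solving the `ν`-viscous lattice within `[0,s]` (`ν ≥ 0`), vanishing at time `0`
on shell `n+1`.  If the modes outside `A` vanish on shell `n` along `[0,s]`, no mode of `A` feeds a mode
outside `B` (`α a a i (0,0,1) = 0`), and no in-shell coupling of two modes of `B` drives a mode outside `B`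
(`α a b i (0,0,0) = 0`), then the modes outside `B` vanish on shell `n+1` along `[0,s]`: their energy `y`
obeys `y' ≤ 160·M·(1+ε₀)^{5(n+1)/2}·y`, `y(0) = 0` (Grönwall). MODEL lattice statement.
[cite: Teschl2012, §2.4 (Grönwall)] -/
theorem kpProper_dark_step (hs : IsSymmetricCoeff α) (hc : IsCancellingCoeff α)
    (hO : ∀ (Y : Fin 4 → ℤ → ℝ → ℝ) (τ : ℝ), (∀ (j : Fin 4) (k : ℤ), 1 ≤ k → 0 ≤ Y j k τ) →
      ∀ δ : ℝ, 0 < δ → ∀ (i : Fin 4) (n : ℤ), 1 ≤ n → Y i n τ = 0 → 0 ≤ quadTerm δ α Y i n τ)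
    (hD : ∀ a b i : Fin 4, a ≠ b → α a b i (0, 0, 1) = 0)
    (hα1 : ∀ (a b i : Fin 4) (μ : ℤ × ℤ × ℤ), μ ∈ shiftSet → |α a b i μ| ≤ 1)
    {ε₀ ν s M : ℝ} (hε : 0 < 1 + ε₀) (hν : 0 ≤ ν) {X : Fin 4 → ℤ → ℝ → ℝ}
    (hXc : ∀ (i : Fin 4) (k : ℤ), Continuous (X i k))
    (hode : ∀ (i : Fin 4) (k : ℤ), ∀ t ∈ Icc (0 : ℝ) s, HasDerivWithinAt (X i k)
      (quadTerm ε₀ α X i k t - ν * (1 + ε₀) ^ ((2 : ℝ) * k) * X i k t) (Icc (0 : ℝ) s) t)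
    (hM : ∀ (t : ℝ) (i : Fin 4) (k : ℤ), |X i k t| ≤ M)
    (n : ℤ) (h0 : ∀ i, X i (n + 1) 0 = 0) (A B : Finset (Fin 4))
    (hF : ∀ i, i ∉ B → ∀ a ∈ A, α a a i (0, 0, 1) = 0)
    (hPT : ∀ i, i ∉ B → ∀ a ∈ B, ∀ b ∈ B, α a b i (0, 0, 0) = 0)
    (hdark : ∀ a, a ∉ A → ∀ t ∈ Icc (0 : ℝ) s, X a n t = 0) :
    ∀ i, i ∉ B → ∀ t ∈ Icc (0 : ℝ) s, X i (n + 1) t = 0 := by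
  have hM0 : 0 ≤ M := (abs_nonneg _).trans (hM 0 0 0)
  set L : ℝ := (1 + ε₀) ^ ((5 : ℝ) * (((n + 1 : ℤ)) : ℝ) / 2) with hL
  have hLpos : 0 < L := Real.rpow_pos_of_pos hε _
  -- the dark energy of shell `n+1` and its derivative
  set y : ℝ → ℝ := fun τ => ∑ d ∈ Bᶜ, (1 / 2 : ℝ) * X d (n + 1) τ ^ 2 with hy
  set y' : ℝ → ℝ := fun τ => ∑ d ∈ Bᶜ, X d (n + 1) τ * quadTerm ε₀ α X d (n + 1) τ -
    2 * (ν * (1 + ε₀) ^ ((2 : ℝ) * ((n + 1 : ℤ) : ℝ))) * ∑ d ∈ Bᶜ, (1 / 2 : ℝ) * X d (n + 1) τ ^ 2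
    with hy'
  have hyc : ContinuousOn y (Icc 0 s) :=
    (forwardSourceSmoothing_continuous_denergy Bᶜ (n + 1) (fun i => hXc i _)).continuousOn
  have hyd : ∀ τ ∈ Icc (0 : ℝ) s, HasDerivWithinAt y (y' τ) (Icc 0 s) τ := fun τ hτ =>
    forwardSourceSmoothing_hasDerivWithinAt_denergy Bᶜ (n + 1) (fun i => hode i (n + 1)) hτ
  have hy_nonneg : ∀ τ, 0 ≤ y τ := fun τ => Finset.sum_nonneg fun d _ => by positivity
  -- the pointwise bound `X_d · quadTerm_d ≤ 40 M L · y`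
  have hpt : ∀ τ ∈ Icc (0 : ℝ) s, ∀ d, d ∉ B →
      X d (n + 1) τ * quadTerm ε₀ α X d (n + 1) τ ≤ 40 * M * L * y τ := by
    intro τ hτ d hd
    rw [kpProper_quadTerm hs hc hO hD ε₀ X d (n + 1) τ]
    have hfeed : ∑ a, α a a d (0, 0, 1) * X a (n + 1 - 1) τ ^ 2 = 0 := by
      refine Finset.sum_eq_zero fun a _ => ?_
      by_cases ha : a ∈ A
      · rw [hF d hd a ha, zero_mul]
      · rw [add_sub_cancel_right, hdark a ha τ hτ]; ring
    have hdrain : -(X d (n + 1) τ * (L * (X d (n + 1) τ * ∑ j, α d d j (0, 0, 1) * X j (n + 1 + 1) τ))) ≤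
        4 * M * L * X d (n + 1) τ ^ 2 :=
      kpDark_drain_le (fun j => α d d j (0, 0, 1)) (fun j => X j (n + 1 + 1) τ)
        (fun j => hα1 d d j _ kpProper_mem001) (fun j => hM τ j _) hLpos.le
    have hin : X d (n + 1) τ * ∑ a, ∑ b, α a b d (0, 0, 0) * (X a (n + 1) τ * X b (n + 1) τ) ≤
        32 * M * y τ :=
      kpDark_inShell_le (fun a b => α a b d (0, 0, 0)) (fun a => X a (n + 1) τ)
        (fun a b => hα1 a b d _ ((mem_shiftSet_iff _).2 (Or.inl rfl))) (fun a => hM τ a _) B (hPT d hd) hd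
    have hdy : (1 / 2 : ℝ) * X d (n + 1) τ ^ 2 ≤ y τ :=
      Finset.single_le_sum (f := fun e => (1 / 2 : ℝ) * X e (n + 1) τ ^ 2) (fun e _ => by positivity)
        (Finset.mem_compl.2 hd)
    rw [hfeed, mul_zero]
    have hsplit : X d (n + 1) τ * (0 - L * (X d (n + 1) τ * ∑ j, α d d j (0, 0, 1) * X j (n + 1 + 1) τ) +
        L * ∑ a, ∑ b, α a b d (0, 0, 0) * (X a (n + 1) τ * X b (n + 1) τ)) =
        -(X d (n + 1) τ * (L * (X d (n + 1) τ * ∑ j, α d d j (0, 0, 1) * X j (n + 1 + 1) τ))) +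
        L * (X d (n + 1) τ * ∑ a, ∑ b, α a b d (0, 0, 0) * (X a (n + 1) τ * X b (n + 1) τ)) := by ring
    rw [hsplit]
    have h2 : L * (X d (n + 1) τ * ∑ a, ∑ b, α a b d (0, 0, 0) * (X a (n + 1) τ * X b (n + 1) τ)) ≤
        L * (32 * M * y τ) := mul_le_mul_of_nonneg_left hin hLpos.le
    have hML : 0 ≤ M * L := mul_nonneg hM0 hLpos.le
    have h3 : M * L * ((1 / 2 : ℝ) * X d (n + 1) τ ^ 2) ≤ M * L * y τ := mul_le_mul_of_nonneg_left hdy hML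
    linarith [hdrain, h2, h3]
  -- the differential inequality `y' ≤ 160 M L · y`
  have hb : ∀ τ ∈ Icc (0 : ℝ) s, y' τ ≤ 160 * M * L * y τ + 0 := by
    intro τ hτ
    have hsum : ∑ d ∈ Bᶜ, X d (n + 1) τ * quadTerm ε₀ α X d (n + 1) τ ≤ 160 * M * L * y τ := by
      have h1 : ∑ d ∈ Bᶜ, X d (n + 1) τ * quadTerm ε₀ α X d (n + 1) τ ≤
          ∑ _d ∈ Bᶜ, 40 * M * L * y τ :=
        Finset.sum_le_sum fun d hd => hpt τ hτ d (Finset.mem_compl.1 hd)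
      have h2 : ∑ _d ∈ Bᶜ, 40 * M * L * y τ = (Bᶜ.card : ℝ) * (40 * M * L * y τ) := by
        rw [Finset.sum_const, nsmul_eq_mul]
      have h3 : (Bᶜ.card : ℝ) ≤ 4 := by
        have : Bᶜ.card ≤ 4 := (Finset.card_le_univ _).trans (by simp)
        exact_mod_cast this
      have h4 : 0 ≤ 40 * M * L * y τ := by
        have := hy_nonneg τ
        positivity
      rw [h2] at h1
      nlinarith
    have hdiss : 0 ≤ 2 * (ν * (1 + ε₀) ^ ((2 : ℝ) * ((n + 1 : ℤ) : ℝ))) * y τ :=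
      mul_nonneg (mul_nonneg (by norm_num) (mul_nonneg hν (Real.rpow_pos_of_pos hε _).le))
        (hy_nonneg τ)
    have : y' τ = (∑ d ∈ Bᶜ, X d (n + 1) τ * quadTerm ε₀ α X d (n + 1) τ) -
        2 * (ν * (1 + ε₀) ^ ((2 : ℝ) * ((n + 1 : ℤ) : ℝ))) * y τ := by
      simp only [hy', hy]
    rw [this]
    linarith
  have hy0 : y 0 = 0 := by
    simp only [hy]
    exact Finset.sum_eq_zero fun d _ => by rw [h0 d]; ring
  intro i hi t ht
  have h := forwardSourceSmoothing_le_gronwallBound hyc hyd hb t ht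
  rw [hy0, gronwallBound_ε0_δ0] at h
  have hyt : y t = 0 := le_antisymm h (hy_nonneg t)
  have hterm : (1 / 2 : ℝ) * X i (n + 1) t ^ 2 = 0 := by
    have := (Finset.sum_eq_zero_iff_of_nonneg (fun d _ => by positivity)).1 hyt i
      (Finset.mem_compl.2 hi)
    simpa using this
  have : X i (n + 1) t ^ 2 = 0 := by linarith
  exact pow_eq_zero_iff (n := 2) (by norm_num) |>.1 this

/-! ## §3 Dark modes stay dark: induction along a lit-set certificate -/

/-- **ZERO PROPAGATION ALONG A LIT-SET CERTIFICATE.**  Let `A : ℕ → Finset (Fin 4)` satisfy `A 0 = univ`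
and, at every shell `n`, the two closure clauses: a mode outside `A (n+1)` is fed by no mode of `A n`
(`α a a i (0,0,1) = 0`) and driven by no in-shell coupling of two modes of `A (n+1)` (`α a b i (0,0,0) = 0`).
Then along every bounded continuous solution of the `ν`-viscous lattice (`ν ≥ 0`) within `[0,s]` from a
one-shell datum on shell `0`, `X_{i,n} ≡ 0` on `[0,s]` for every `n` and every `i ∉ A n`. MODEL lattice
statement. [cite: Teschl2012, §2.4 (Grönwall)] -/
theorem kpProper_dark_zero (hs : IsSymmetricCoeff α) (hc : IsCancellingCoeff α)
    (hO : ∀ (Y : Fin 4 → ℤ → ℝ → ℝ) (τ : ℝ), (∀ (j : Fin 4) (k : ℤ), 1 ≤ k → 0 ≤ Y j k τ) →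
      ∀ δ : ℝ, 0 < δ → ∀ (i : Fin 4) (n : ℤ), 1 ≤ n → Y i n τ = 0 → 0 ≤ quadTerm δ α Y i n τ)
    (hD : ∀ a b i : Fin 4, a ≠ b → α a b i (0, 0, 1) = 0)
    (hα1 : ∀ (a b i : Fin 4) (μ : ℤ × ℤ × ℤ), μ ∈ shiftSet → |α a b i μ| ≤ 1)
    {ε₀ ν s M : ℝ} (hε : 0 < 1 + ε₀) (hν : 0 ≤ ν) {X₀ : Fin 4 → ℝ} {X : Fin 4 → ℤ → ℝ → ℝ}
    (hdat : ∀ (i : Fin 4) (k : ℤ), X i k 0 = if k = 0 then X₀ i else 0)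
    (hXc : ∀ (i : Fin 4) (k : ℤ), Continuous (X i k))
    (hode : ∀ (i : Fin 4) (k : ℤ), ∀ t ∈ Icc (0 : ℝ) s, HasDerivWithinAt (X i k)
      (quadTerm ε₀ α X i k t - ν * (1 + ε₀) ^ ((2 : ℝ) * k) * X i k t) (Icc (0 : ℝ) s) t)
    (hM : ∀ (t : ℝ) (i : Fin 4) (k : ℤ), |X i k t| ≤ M)
    (A : ℕ → Finset (Fin 4)) (hA0 : ∀ i, i ∈ A 0)
    (hF : ∀ (n : ℕ) (i : Fin 4), i ∉ A (n + 1) → ∀ a ∈ A n, α a a i (0, 0, 1) = 0)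
    (hPT : ∀ (n : ℕ) (i : Fin 4), i ∉ A (n + 1) → ∀ a ∈ A (n + 1), ∀ b ∈ A (n + 1), α a b i (0, 0, 0) = 0) :
    ∀ (n : ℕ) (i : Fin 4), i ∉ A n → ∀ t ∈ Icc (0 : ℝ) s, X i (n : ℤ) t = 0 := by
  intro n
  induction n with
  | zero => exact fun i hi => absurd (hA0 i) hi
  | succ n ih =>
    intro i hi t ht
    have h0 : ∀ j, X j ((n : ℤ) + 1) 0 = 0 := fun j => by
      rw [hdat, if_neg (by omega)]
    have h := kpProper_dark_step hs hc hO hD hα1 hε hν hXc hode hM (n : ℤ) h0 (A n) (A (n + 1))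
      (hF n) (hPT n) ih i hi t ht
    push_cast
    exact h

end Summit.NavierStokesRegularity.NavierStokesRegularity.Theorems

end
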